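/-
Copyright: cell `pub-balaban-gaps` (G2), seat ne6 (row NE7b), `prover-pub-balaban-gaps-ne6-g11-0`. Released under the licence of the
surrounding project.
-/
import Summits.QuantumFields.BalabanUV.T4Continuum.Spine.NE7b.CompactFibreWindowSU2

/-!
# CENTRED WINDOWS AND THE SHIFTED INTERACTION LETTER (`SU(2)`): a Haar ball around ANY centre `U₀` has the mass of the ball around `1`,
# and the Wilson plaquette EXCESS over a centre configuration is `≤ (β∕2)·4ρ·(2s + 4ρ)` per plaquette on the `ρ`-window around it
# (row NE7b, node U5c; the refuter's exit σ-ne7bref-g69-1 (a) ∕ PRICING-NE7b v76 F413 Parts G–H, as kernel lemmas)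

Cell `pub-balaban-gaps` (G2 spine census) for the `pub-balaban` T⁴ crux NE7b (`T4WeightBudget.RelWeightBound`; the cell's OWN
estimate — NOT PRINTED in [Bałaban 1983–89], NOT PROVED).  Crux-route work under `Spine/NE7b/`; NOTHING of Bałaban's is named or
asserted; no `T4Continuum/Support` leaf typed; no `def`; zero `sorry`.  Imports this seat's `CompactFibreWindowSU2` only.

WHY.  `CompactFibreWindowSU2` §4 values the window-smallness letter `hIsmall : I ≤ i⁺` of the OWNER's `compactFibre_moment_le` for the
ABSOLUTE Wilson terms on a window around the IDENTITY: `8βη` per plaquette.  The refuter priced it (PRICING-NE7b v76 F413 Part G, in the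
cell's grammar G15): at print's bond window `η = (M₀ε_k)²` and `β = g_k⁻²` this is `8M₀²p₀²` per windowed plaquette — OVER budget; the
ABSOLUTE letter with a fixed centre is dead BY VALUE (κ-ne7bref-g69-1), and the exit (σ-ne7bref-g69-1 (a), Part H) is to CENTRE the window at
a background-dependent configuration `U₀(y)` (print: the boundary-data minimiser, [Balaban1989LargeFieldI] (1.3)) and to carry as `I` the
EXCESS `A(U) − A(U₀)`: «`|A_p(U) − A_p(U₀)| ≤ ½β·4rg·(2√2p₀g + 4rg) = 4√2·r·p₀ + 8r²` per plaquette … the mass letter … moved to the centre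
`U₀(y)` by Haar left-invariance».  THIS FILE supplies exactly those two [folklore] letters in the `SU(2) ↔ S³ ⊂ ℍ` model of the tree:

* §1 CENTRED WINDOWS.  `norm_su2Quat_inv_mul_sub_one` (`‖su2Quat(U₀⁻¹U) − 1‖ = ‖su2Quat U − su2Quat U₀‖`), `centredBall_eq_preimage`,
  **`haar_centredBall_eq`** (the Haar mass of `{‖su2Quat U − su2Quat U₀‖ ≤ ε}` does not depend on `U₀` — left invariance,
  `measure_preimage_mul`), `haar_centredBall_toReal_ge` (`≥ ε⁴∕16`, `0 < ε ≤ 1∕2`), and for a centre CONFIGURATION `U₀ : bonds → SU(2)`: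
  `pi_centredBall_toReal_eq`, **`neg_log_pi_centredBall_le`** (`−log κ(Π_b B(U₀ b, ε)) ≤ #bonds·(4 log ε⁻¹ + log 16)`).
* §2 THE SHIFTED INTERACTION LETTER.  Unit-quaternion algebra `norm_mul_sub_mul_le` (`‖pq − p′q′‖ ≤ ‖p − p′‖ + ‖q − q′‖`),
  `norm_su2Quat_inv_sub_inv` (`‖su2Quat U⁻¹ − su2Quat V⁻¹‖ = ‖su2Quat U − su2Quat V‖`), **`norm_su2Quat_word_sub_word_le`** (plaquette words
  `U₁U₂U₃⁻¹U₄⁻¹` vs `V₁V₂V₃⁻¹V₄⁻¹`: `≤ Σᵢ‖su2Quat Uᵢ − su2Quat Vᵢ‖`), `wilsonPlaquette_eq_half_norm_sq` (`1 − ½Re tr U = ½‖su2Quat U − 1‖²`),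
  **`abs_wilsonPlaquette_sub_le`** (`|β(1 − ½Re tr U) − β(1 − ½Re tr V)| ≤ (β∕2)·d·(2s + d)` when `‖su2Quat U − su2Quat V‖ ≤ d` and
  `‖su2Quat V − 1‖ ≤ s`), **`abs_excess_le_of_centredWindow`** (four bonds within `ρ` of the centre's bonds, centre plaquette within `s` of
  `1` ⊢ excess `≤ (β∕2)·(4ρ)·(2s + 4ρ)`), `excess_sum_le_of_centredWindow` (summed over the plaquettes touching the region:
  `≤ #s·((β∕2)·(4ρ)·(2s + 4ρ))`), `excess_signed_sum_le_of_centredWindow` (the signed sum, the form a relative display's `I ≤ m(y) + i₀` consumes).  At `β = g⁻²`, `ρ = r·g`, `s = √2·p₀·g` this is the refuter's `4√2·r·p₀ + 8r²` per plaquette.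

HONEST REMARKS.  That the creation-level numerator is carried by the POSITIVITY of the EXCESS over the boundary-data minimiser (print's
(1.3)–(1.5)) and which `r, p₀` enter are (A3) ∕ (A1c) readings — NOT asserted; the minimiser itself is not constructed here (any centre
configuration `U₀` is allowed).  Nothing of Bałaban's is asserted, valued or discharged.  NE7b NOT PRINTED ∕ NOT PROVED; spine PROVED 0∕9;
rung (B)+1 on a FINITE torus — NOT infinite volume, NOT the mass gap, NOT Clay.
HONEST DEPENDENCY: continuum YM on T⁴ ⇐ BetaPertH ∧ nine spine estimates (0/9 proved); BetaPertH ⇐ (D1) ∧ (D4) ∧ CAP+tail;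
G-an2-4 gates asym, D1 and NE2/3/4.  This file changes none of it.
-/

set_option autoImplicit false

open MeasureTheory Real Finset
open scoped Quaternion
open Literature.MathematicalPhysics.QuantumFieldTheory (haarProbability)
open Literature.MathematicalPhysics.QuantumLattice (su2Quat norm_su2Quat)
open Literature.MathematicalPhysics.QuantumFieldTheory.Balaban1983to89.T4HaarSU2Translate (su2Quat_mul su2Quat_one continuous_su2Quat)
open Summit.QuantumFields.BalabanUV.T4Continuum.NE7b.CompactFibreCarrier
open Summit.QuantumFields.BalabanUV.T4Continuum.NE7b.CompactFibreWindowSU2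

namespace Summit.QuantumFields.BalabanUV.T4Continuum.NE7b.CompactFibreWindowCentred

noncomputable section

/-! Conventions: `SU(2) = Matrix.specialUnitaryGroup (Fin 2) ℂ`; the CENTRED ball of radius `ε` around `U₀` is the plain set
`{U : Matrix.specialUnitaryGroup (Fin 2) ℂ | ‖su2Quat U - su2Quat U₀‖ ≤ ε}` (nothing abbreviated, nothing defined). -/

/-! ## §1 Centred windows: the Haar mass of a ball does not depend on its centre -/

/-- `su2Quat` of an inverse is a left inverse: `su2Quat U⁻¹ * su2Quat U = 1`. [folklore] -/
theorem su2Quat_inv_mul (U : Matrix.specialUnitaryGroup (Fin 2) ℂ) : su2Quat U⁻¹ * su2Quat U = 1 := by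
  rw [← su2Quat_mul, inv_mul_cancel, su2Quat_one]

/-- … and a right inverse: `su2Quat U * su2Quat U⁻¹ = 1`. [folklore] -/
theorem su2Quat_mul_inv (U : Matrix.specialUnitaryGroup (Fin 2) ℂ) : su2Quat U * su2Quat U⁻¹ = 1 := by
  rw [← su2Quat_mul, mul_inv_cancel, su2Quat_one]

/-- **TRANSLATION TO THE IDENTITY**: `‖su2Quat(U₀⁻¹U) − 1‖ = ‖su2Quat U − su2Quat U₀‖`. [folklore] -/
theorem norm_su2Quat_inv_mul_sub_one (U₀ U : Matrix.specialUnitaryGroup (Fin 2) ℂ) :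
    ‖su2Quat (U₀⁻¹ * U) - 1‖ = ‖su2Quat U - su2Quat U₀‖ := by
  have e : su2Quat (U₀⁻¹ * U) - 1 = su2Quat U₀⁻¹ * (su2Quat U - su2Quat U₀) := by
    rw [mul_sub, su2Quat_inv_mul, su2Quat_mul]
  rw [e, norm_mul, norm_su2Quat, one_mul]

/-- The centred ball is the preimage of the identity-centred ball under `U ↦ U₀⁻¹U`. [folklore] -/
theorem centredBall_eq_preimage (U₀ : Matrix.specialUnitaryGroup (Fin 2) ℂ) (ε : ℝ) :
    {U : Matrix.specialUnitaryGroup (Fin 2) ℂ | ‖su2Quat U - su2Quat U₀‖ ≤ ε}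
      = (fun U : Matrix.specialUnitaryGroup (Fin 2) ℂ => U₀⁻¹ * U) ⁻¹'
          {U : Matrix.specialUnitaryGroup (Fin 2) ℂ | ‖su2Quat U - 1‖ ≤ ε} := by
  ext U
  simp only [Set.mem_setOf_eq, Set.mem_preimage, norm_su2Quat_inv_mul_sub_one]

/-- **THE HAAR MASS OF A BALL DOES NOT DEPEND ON ITS CENTRE** (left invariance of the Haar probability). [folklore] -/
theorem haar_centredBall_eq (U₀ : Matrix.specialUnitaryGroup (Fin 2) ℂ) (ε : ℝ) :
    haarProbability (Matrix.specialUnitaryGroup (Fin 2) ℂ) {U : Matrix.specialUnitaryGroup (Fin 2) ℂ | ‖su2Quat U - su2Quat U₀‖ ≤ ε}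
      = haarProbability (Matrix.specialUnitaryGroup (Fin 2) ℂ) {U : Matrix.specialUnitaryGroup (Fin 2) ℂ | ‖su2Quat U - 1‖ ≤ ε} := by
  rw [centredBall_eq_preimage, measure_preimage_mul]

/-- Hence the centred bond window has Haar mass `≥ ε⁴∕16` for `0 < ε ≤ 1∕2`, whatever the centre. [folklore] -/
theorem haar_centredBall_toReal_ge {ε : ℝ} (hε0 : 0 < ε) (hε : ε ≤ 1 / 2) (U₀ : Matrix.specialUnitaryGroup (Fin 2) ℂ) :
    ε ^ 4 / 16 ≤ (haarProbability (Matrix.specialUnitaryGroup (Fin 2) ℂ)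
      {U : Matrix.specialUnitaryGroup (Fin 2) ℂ | ‖su2Quat U - su2Quat U₀‖ ≤ ε}).toReal := by
  rw [haar_centredBall_eq]
  exact haar_quatBall_toReal_ge hε0 hε

/-- The centred ball is measurable. [folklore] -/
theorem measurableSet_centredBall (U₀ : Matrix.specialUnitaryGroup (Fin 2) ℂ) (ε : ℝ) :
    MeasurableSet {U : Matrix.specialUnitaryGroup (Fin 2) ℂ | ‖su2Quat U - su2Quat U₀‖ ≤ ε} := by
  have hc : Continuous fun U : Matrix.specialUnitaryGroup (Fin 2) ℂ => ‖su2Quat U - su2Quat U₀‖ :=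
    (continuous_su2Quat.sub continuous_const).norm
  exact (isClosed_le hc continuous_const).measurableSet

section Region

variable {B : Type*} [Fintype B]

/-- **PRODUCT CENTRED WINDOW, PRODUCT MASS**: for a centre configuration `U₀ : bonds → SU(2)` the product of the centred bond balls has mass
`Haar{‖su2Quat U − 1‖ ≤ ε}^{#bonds}` — the same as around the identity configuration. [folklore] -/
theorem pi_centredBall_toReal_eq (U₀ : B → Matrix.specialUnitaryGroup (Fin 2) ℂ) (ε : ℝ) :
    ((Measure.pi fun _ : B => haarProbability (Matrix.specialUnitaryGroup (Fin 2) ℂ))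
        (Set.univ.pi fun b : B => {U : Matrix.specialUnitaryGroup (Fin 2) ℂ | ‖su2Quat U - su2Quat (U₀ b)‖ ≤ ε})).toReal
      = ((haarProbability (Matrix.specialUnitaryGroup (Fin 2) ℂ)
          {U : Matrix.specialUnitaryGroup (Fin 2) ℂ | ‖su2Quat U - 1‖ ≤ ε}).toReal) ^ Fintype.card B := by
  rw [pi_window_measure]
  simp_rw [haar_centredBall_eq]
  rw [Finset.prod_const, Finset.card_univ]

/-- **THE CENTRED VOLUME LETTER BY VALUE**: `−log κ(Π_b B(U₀ b, ε)) ≤ #bonds·(4 log ε⁻¹ + log 16)` for `0 < ε ≤ 1∕2`, any centre configuration;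
and the product window has positive mass. [folklore] -/
theorem neg_log_pi_centredBall_le {ε : ℝ} (hε0 : 0 < ε) (hε : ε ≤ 1 / 2) (U₀ : B → Matrix.specialUnitaryGroup (Fin 2) ℂ) :
    0 < ((Measure.pi fun _ : B => haarProbability (Matrix.specialUnitaryGroup (Fin 2) ℂ))
        (Set.univ.pi fun b : B => {U : Matrix.specialUnitaryGroup (Fin 2) ℂ | ‖su2Quat U - su2Quat (U₀ b)‖ ≤ ε})).toReal ∧
    -Real.log ((Measure.pi fun _ : B => haarProbability (Matrix.specialUnitaryGroup (Fin 2) ℂ))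
        (Set.univ.pi fun b : B => {U : Matrix.specialUnitaryGroup (Fin 2) ℂ | ‖su2Quat U - su2Quat (U₀ b)‖ ≤ ε})).toReal
      ≤ (Fintype.card B : ℝ) * (4 * Real.log ε⁻¹ + Real.log 16) := by
  have hm : ε ^ 4 / 16 ≤ (haarProbability (Matrix.specialUnitaryGroup (Fin 2) ℂ)
      {U : Matrix.specialUnitaryGroup (Fin 2) ℂ | ‖su2Quat U - 1‖ ≤ ε}).toReal := haar_quatBall_toReal_ge hε0 hε
  have hpos1 : 0 < (haarProbability (Matrix.specialUnitaryGroup (Fin 2) ℂ)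
      {U : Matrix.specialUnitaryGroup (Fin 2) ℂ | ‖su2Quat U - 1‖ ≤ ε}).toReal := lt_of_lt_of_le (by positivity) hm
  have hlog1 : -Real.log (haarProbability (Matrix.specialUnitaryGroup (Fin 2) ℂ)
      {U : Matrix.specialUnitaryGroup (Fin 2) ℂ | ‖su2Quat U - 1‖ ≤ ε}).toReal ≤ 4 * Real.log ε⁻¹ + Real.log 16 := by
    have h := Real.log_le_log (by positivity) hm
    rw [Real.log_div (by positivity) (by norm_num), Real.log_pow] at h
    rw [Real.log_inv]; push_cast at h; linarith
  rw [pi_centredBall_toReal_eq]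
  refine ⟨pow_pos hpos1 _, ?_⟩
  rw [Real.log_pow, ← mul_neg]
  exact mul_le_mul_of_nonneg_left hlog1 (Nat.cast_nonneg _)

end Region

/-! ## §2 The shifted interaction letter: the Wilson plaquette excess over a centre configuration -/

/-- Unit quaternions: `‖p·q − p′·q′‖ ≤ ‖p − p′‖ + ‖q − q′‖` (`‖p‖ = ‖q′‖ = 1`). [folklore] -/
theorem norm_mul_sub_mul_le {p q' : ℍ} (hp : ‖p‖ = 1) (hq' : ‖q'‖ = 1) (p' q : ℍ) :
    ‖p * q - p' * q'‖ ≤ ‖p - p'‖ + ‖q - q'‖ := by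
  have e : p * q - p' * q' = p * (q - q') + (p - p') * q' := by
    rw [mul_sub, sub_mul]; abel
  calc ‖p * q - p' * q'‖ = ‖p * (q - q') + (p - p') * q'‖ := by rw [e]
    _ ≤ ‖p * (q - q')‖ + ‖(p - p') * q'‖ := norm_add_le _ _
    _ = ‖q - q'‖ + ‖p - p'‖ := by rw [norm_mul, norm_mul, hp, hq', one_mul, mul_one]
    _ = ‖p - p'‖ + ‖q - q'‖ := add_comm _ _

/-- `‖su2Quat(U·V) − su2Quat(U′·V′)‖ ≤ ‖su2Quat U − su2Quat U′‖ + ‖su2Quat V − su2Quat V′‖`. [folklore] -/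
theorem norm_su2Quat_mul_sub_mul_le (U V U' V' : Matrix.specialUnitaryGroup (Fin 2) ℂ) :
    ‖su2Quat (U * V) - su2Quat (U' * V')‖ ≤ ‖su2Quat U - su2Quat U'‖ + ‖su2Quat V - su2Quat V'‖ := by
  rw [su2Quat_mul, su2Quat_mul]
  exact norm_mul_sub_mul_le (norm_su2Quat U) (norm_su2Quat V') _ _

/-- Inversion is an isometry for the quaternion distance: `‖su2Quat U⁻¹ − su2Quat V⁻¹‖ = ‖su2Quat U − su2Quat V‖`
(`q(U⁻¹) − q(V⁻¹) = q(U⁻¹)·(q(V) − q(U))·q(V⁻¹)`). [folklore] -/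
theorem norm_su2Quat_inv_sub_inv (U V : Matrix.specialUnitaryGroup (Fin 2) ℂ) :
    ‖su2Quat U⁻¹ - su2Quat V⁻¹‖ = ‖su2Quat U - su2Quat V‖ := by
  have e : su2Quat U⁻¹ - su2Quat V⁻¹ = su2Quat U⁻¹ * (su2Quat V - su2Quat U) * su2Quat V⁻¹ := by
    rw [mul_sub, sub_mul, mul_assoc, su2Quat_mul_inv, mul_one, su2Quat_inv_mul, one_mul]
  rw [e, norm_mul, norm_mul, norm_su2Quat, norm_su2Quat, one_mul, mul_one, norm_sub_rev]

/-- **PLAQUETTE WORDS ARE 1-LIPSCHITZ IN EACH BOND**: `‖su2Quat(U₁U₂U₃⁻¹U₄⁻¹) − su2Quat(V₁V₂V₃⁻¹V₄⁻¹)‖ ≤ Σᵢ ‖su2Quat Uᵢ − su2Quat Vᵢ‖`.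
[folklore] -/
theorem norm_su2Quat_word_sub_word_le (U₁ U₂ U₃ U₄ V₁ V₂ V₃ V₄ : Matrix.specialUnitaryGroup (Fin 2) ℂ) :
    ‖su2Quat (U₁ * U₂ * U₃⁻¹ * U₄⁻¹) - su2Quat (V₁ * V₂ * V₃⁻¹ * V₄⁻¹)‖ ≤
      ‖su2Quat U₁ - su2Quat V₁‖ + ‖su2Quat U₂ - su2Quat V₂‖ + ‖su2Quat U₃ - su2Quat V₃‖ + ‖su2Quat U₄ - su2Quat V₄‖ := by
  have h12 := norm_su2Quat_mul_sub_mul_le U₁ U₂ V₁ V₂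
  have h123 := norm_su2Quat_mul_sub_mul_le (U₁ * U₂) U₃⁻¹ (V₁ * V₂) V₃⁻¹
  have h1234 := norm_su2Quat_mul_sub_mul_le (U₁ * U₂ * U₃⁻¹) U₄⁻¹ (V₁ * V₂ * V₃⁻¹) V₄⁻¹
  rw [norm_su2Quat_inv_sub_inv] at h123 h1234
  linarith

/-- **THE WILSON PLAQUETTE TERM IS HALF A SQUARED DISTANCE**: `1 − ½Re tr U = ½‖su2Quat U − 1‖²`. [folklore] -/
theorem wilsonPlaquette_eq_half_norm_sq (U : Matrix.specialUnitaryGroup (Fin 2) ℂ) :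
    1 - (1 / 2 : ℝ) * ((U : Matrix (Fin 2) (Fin 2) ℂ).trace).re = (1 / 2 : ℝ) * ‖su2Quat U - 1‖ ^ 2 := by
  rw [norm_su2Quat_sub_one_sq]; ring

/-- **THE EXCESS OF ONE PLAQUETTE TERM**: if `‖su2Quat U − su2Quat V‖ ≤ d` and the comparison plaquette is small-field, `‖su2Quat V − 1‖ ≤ s`,
then `|β(1 − ½Re tr U) − β(1 − ½Re tr V)| ≤ (β∕2)·d·(2s + d)` (`|a² − b²| = |a − b|(a + b)`, `|a − b| ≤ d`, `a + b ≤ 2s + d`). [folklore] -/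
theorem abs_wilsonPlaquette_sub_le {β d s : ℝ} (hβ : 0 ≤ β) (U V : Matrix.specialUnitaryGroup (Fin 2) ℂ)
    (hd : ‖su2Quat U - su2Quat V‖ ≤ d) (hs : ‖su2Quat V - 1‖ ≤ s) :
    |β * (1 - (1 / 2 : ℝ) * ((U : Matrix (Fin 2) (Fin 2) ℂ).trace).re)
        - β * (1 - (1 / 2 : ℝ) * ((V : Matrix (Fin 2) (Fin 2) ℂ).trace).re)| ≤ β / 2 * d * (2 * s + d) := by
  rw [wilsonPlaquette_eq_half_norm_sq, wilsonPlaquette_eq_half_norm_sq]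
  set a := ‖su2Quat U - 1‖ with ha
  set b := ‖su2Quat V - 1‖ with hb
  have ha0 : 0 ≤ a := norm_nonneg _
  have hb0 : 0 ≤ b := norm_nonneg _
  have hab : |a - b| ≤ d := by
    calc |a - b| ≤ ‖(su2Quat U - 1) - (su2Quat V - 1)‖ := abs_norm_sub_norm_le _ _
      _ = ‖su2Quat U - su2Quat V‖ := by rw [sub_sub_sub_cancel_right]
      _ ≤ d := hd
  have hd0 : 0 ≤ d := (abs_nonneg _).trans hab
  have hsum : a + b ≤ 2 * s + d := by
    have : a ≤ b + d := by linarith [(abs_le.1 hab).2]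
    linarith
  have key : |a ^ 2 - b ^ 2| ≤ d * (2 * s + d) := by
    rw [sq_sub_sq, abs_mul, abs_of_nonneg (by linarith : 0 ≤ a + b), mul_comm]
    exact mul_le_mul hab hsum (by linarith) hd0
  rw [← mul_sub, ← mul_sub, abs_mul, abs_mul, abs_of_nonneg hβ, abs_of_nonneg (by norm_num : (0 : ℝ) ≤ 1 / 2)]
  nlinarith

/-- **THE SHIFTED INTERACTION LETTER, ONE PLAQUETTE**: four bonds within `ρ` of the centre's bonds (`‖su2Quat Uᵢ − su2Quat Vᵢ‖ ≤ ρ`) and a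
small-field centre plaquette (`‖su2Quat(V₁V₂V₃⁻¹V₄⁻¹) − 1‖ ≤ s`) give an excess `≤ (β∕2)·(4ρ)·(2s + 4ρ)` — the refuter's
`4√2·r·p₀ + 8r²` at `β = g⁻²`, `ρ = r·g`, `s = √2·p₀·g`. [folklore] -/
theorem abs_excess_le_of_centredWindow {β ρ s : ℝ} (hβ : 0 ≤ β)
    (U₁ U₂ U₃ U₄ V₁ V₂ V₃ V₄ : Matrix.specialUnitaryGroup (Fin 2) ℂ)
    (h₁ : ‖su2Quat U₁ - su2Quat V₁‖ ≤ ρ) (h₂ : ‖su2Quat U₂ - su2Quat V₂‖ ≤ ρ)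
    (h₃ : ‖su2Quat U₃ - su2Quat V₃‖ ≤ ρ) (h₄ : ‖su2Quat U₄ - su2Quat V₄‖ ≤ ρ)
    (hs : ‖su2Quat (V₁ * V₂ * V₃⁻¹ * V₄⁻¹) - 1‖ ≤ s) :
    |β * (1 - (1 / 2 : ℝ) * (((U₁ * U₂ * U₃⁻¹ * U₄⁻¹ : Matrix.specialUnitaryGroup (Fin 2) ℂ) : Matrix (Fin 2) (Fin 2) ℂ).trace).re)
      - β * (1 - (1 / 2 : ℝ) * (((V₁ * V₂ * V₃⁻¹ * V₄⁻¹ : Matrix.specialUnitaryGroup (Fin 2) ℂ) : Matrix (Fin 2) (Fin 2) ℂ).trace).re)|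
      ≤ β / 2 * (4 * ρ) * (2 * s + 4 * ρ) :=
  abs_wilsonPlaquette_sub_le hβ _ _ (by linarith [norm_su2Quat_word_sub_word_le U₁ U₂ U₃ U₄ V₁ V₂ V₃ V₄]) hs

/-- **SUMMED OVER THE PLAQUETTES TOUCHING THE REGION**: with bond maps `b₁ … b₄` (the configuration) and `c₁ … c₄` (the centre), each bond
within `ρ` of its centre and each centre plaquette `s`-small-field, the total excess is `≤ #s·((β∕2)·(4ρ)·(2s + 4ρ))`. [folklore] -/
theorem excess_sum_le_of_centredWindow {P : Type*} (s : Finset P) {β ρ σ : ℝ} (hβ : 0 ≤ β)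
    (b₁ b₂ b₃ b₄ c₁ c₂ c₃ c₄ : P → Matrix.specialUnitaryGroup (Fin 2) ℂ)
    (hρ : ∀ p ∈ s, ‖su2Quat (b₁ p) - su2Quat (c₁ p)‖ ≤ ρ ∧ ‖su2Quat (b₂ p) - su2Quat (c₂ p)‖ ≤ ρ ∧
      ‖su2Quat (b₃ p) - su2Quat (c₃ p)‖ ≤ ρ ∧ ‖su2Quat (b₄ p) - su2Quat (c₄ p)‖ ≤ ρ)
    (hσ : ∀ p ∈ s, ‖su2Quat (c₁ p * c₂ p * (c₃ p)⁻¹ * (c₄ p)⁻¹) - 1‖ ≤ σ) :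
    ∑ p ∈ s, |β * (1 - (1 / 2 : ℝ) * (((b₁ p * b₂ p * (b₃ p)⁻¹ * (b₄ p)⁻¹ : Matrix.specialUnitaryGroup (Fin 2) ℂ) :
        Matrix (Fin 2) (Fin 2) ℂ).trace).re)
      - β * (1 - (1 / 2 : ℝ) * (((c₁ p * c₂ p * (c₃ p)⁻¹ * (c₄ p)⁻¹ : Matrix.specialUnitaryGroup (Fin 2) ℂ) :
        Matrix (Fin 2) (Fin 2) ℂ).trace).re)|
      ≤ (s.card : ℝ) * (β / 2 * (4 * ρ) * (2 * σ + 4 * ρ)) := by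
  have key : ∀ p ∈ s, |β * (1 - (1 / 2 : ℝ) * (((b₁ p * b₂ p * (b₃ p)⁻¹ * (b₄ p)⁻¹ : Matrix.specialUnitaryGroup (Fin 2) ℂ) :
        Matrix (Fin 2) (Fin 2) ℂ).trace).re)
      - β * (1 - (1 / 2 : ℝ) * (((c₁ p * c₂ p * (c₃ p)⁻¹ * (c₄ p)⁻¹ : Matrix.specialUnitaryGroup (Fin 2) ℂ) :
        Matrix (Fin 2) (Fin 2) ℂ).trace).re)| ≤ β / 2 * (4 * ρ) * (2 * σ + 4 * ρ) :=
    fun p hp => abs_excess_le_of_centredWindow hβ _ _ _ _ _ _ _ _ (hρ p hp).1 (hρ p hp).2.1 (hρ p hp).2.2.1 (hρ p hp).2.2.2 (hσ p hp)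
  calc _ ≤ ∑ _p ∈ s, β / 2 * (4 * ρ) * (2 * σ + 4 * ρ) := Finset.sum_le_sum key
    _ = (s.card : ℝ) * (β / 2 * (4 * ρ) * (2 * σ + 4 * ρ)) := by rw [Finset.sum_const, nsmul_eq_mul]

/-- The SIGNED form the relative display consumes (leaf-01's `CompactFibreRelative` slot `hIrel : I ≤ m y + i₀` with `m y = A(U₀ y)`): the total excess
`Σ_p (A_p(U) − A_p(U₀)) ≤ #s·((β∕2)(4ρ)(2σ + 4ρ))` (each term `≤` its absolute value). [folklore] -/
theorem excess_signed_sum_le_of_centredWindow {P : Type*} (s : Finset P) {β ρ σ : ℝ} (hβ : 0 ≤ β)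
    (b₁ b₂ b₃ b₄ c₁ c₂ c₃ c₄ : P → Matrix.specialUnitaryGroup (Fin 2) ℂ)
    (hρ : ∀ p ∈ s, ‖su2Quat (b₁ p) - su2Quat (c₁ p)‖ ≤ ρ ∧ ‖su2Quat (b₂ p) - su2Quat (c₂ p)‖ ≤ ρ ∧
      ‖su2Quat (b₃ p) - su2Quat (c₃ p)‖ ≤ ρ ∧ ‖su2Quat (b₄ p) - su2Quat (c₄ p)‖ ≤ ρ)
    (hσ : ∀ p ∈ s, ‖su2Quat (c₁ p * c₂ p * (c₃ p)⁻¹ * (c₄ p)⁻¹) - 1‖ ≤ σ) :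
    ∑ p ∈ s, (β * (1 - (1 / 2 : ℝ) * (((b₁ p * b₂ p * (b₃ p)⁻¹ * (b₄ p)⁻¹ : Matrix.specialUnitaryGroup (Fin 2) ℂ) :
        Matrix (Fin 2) (Fin 2) ℂ).trace).re)
      - β * (1 - (1 / 2 : ℝ) * (((c₁ p * c₂ p * (c₃ p)⁻¹ * (c₄ p)⁻¹ : Matrix.specialUnitaryGroup (Fin 2) ℂ) :
        Matrix (Fin 2) (Fin 2) ℂ).trace).re))
      ≤ (s.card : ℝ) * (β / 2 * (4 * ρ) * (2 * σ + 4 * ρ)) :=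
  (Finset.sum_le_sum fun _ _ => le_abs_self _).trans (excess_sum_le_of_centredWindow s hβ b₁ b₂ b₃ b₄ c₁ c₂ c₃ c₄ hρ hσ)

end

end Summit.QuantumFields.BalabanUV.T4Continuum.NE7b.CompactFibreWindowCentred
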